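import Literature.AlgebraicGeometry.Tropical.TropicalTorusWeilCycles
import Summits.HodgeConjecture.HodgeConjecture.Theses.TropicalKugaSatakeCayley

/-!
# Negative-side groundwork for `TropicalKugaSatakeCayley.FormalCycleCriterion` (K3): chain classes are symmetric

Every framed cell's tautological class `(1/p!)·det(coef)·pl(dir) ⊗ weight·pl(dir)` is a rank-one SYMMETRIC
matrix (area bivector and framing are both multiples of `pl(dir)`, because the edges lie in the slope plane),
hence so is the class of every framed chain, cycle or not, effective or not (Zharkov, arXiv:2002.02347, p. 3:
`vol` takes values in `Sym²Γ_p ⊗ Sym²(∧²Γ₂)`). Consequence used by the refuter's load-bearing analysis of K3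
(item stmt-HodgeConjecture-18571, evidence ATTACK.md §4; refuter seat refuter-rattack-stmt-HodgeConjecture-18571-0,
crux-attack at birth, 2026-08-17): a period class `M` is realisable by a chain of the torus
`ℝ^g / Pℤ^g` only if `compound p P * M` is symmetric — which fails, e.g., for the flat-torus class `E_{(01),(01)}`
of the vertex `t = e₀` of the Kuga–Satake family at every parameter with `t'_2 t'_3 ≠ 0`, so the hypothesis
`LinearIndependent ℚ t` of K3 cannot be dropped.
-/

-- The mandated namespace `Summit.<P>.<Sub>.Theorems.…` repeats `HodgeConjecture` (single-conjunct summit).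
set_option linter.dupNamespace false

namespace Summit.HodgeConjecture.HodgeConjecture.Theorems.FormalCycleCriterion.Negative.ClassOfSymmetric

open Literature.AlgebraicGeometry.Tropical.TropicalTorus

variable {S : Type*} [CommRing S] [Algebra ℚ S] {g p : ℕ}

/-- The tautological class of a framed cell is a symmetric matrix. [folklore] -/
theorem cell_classOf_transpose (c : Cell S g p) : c.classOf.transpose = c.classOf := by
  ext K J
  simp only [Cell.classOf, Cell.framing, Matrix.transpose_apply, Matrix.of_apply]
  rw [show (Nat.factorial p : ℚ)⁻¹ * pluecker c.dir J * (c.weight * pluecker c.dir K) =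
      (Nat.factorial p : ℚ)⁻¹ * pluecker c.dir K * (c.weight * pluecker c.dir J) by ring]

/-- The tautological class of a framed chain is a symmetric matrix. [folklore] -/
theorem chain_classOf_transpose (Z : Chain S g p) : Z.classOf.transpose = Z.classOf := by
  unfold Chain.classOf
  rw [Matrix.transpose_sum]
  exact Finset.sum_congr rfl fun c _ => cell_classOf_transpose (Z.cell c)

/-- Hence a target of the form `compound p P⁻¹ * Z.classOf = M` forces `compound p P * M` to be symmetric
whenever `compound p P * (compound p P⁻¹ * X) = X` for the chain class `X` (e.g. `P` invertible and
`compound` multiplicative): the symmetric-realizability obstruction, stated without inverses. [folklore] -/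
theorem periodClass_obstruction (P : Matrix (Fin g) (Fin g) S) (Z : Chain S g p)
    (M : Matrix (Sub g p) (Sub g p) S)
    (hsec : compound p P * (compound p P⁻¹ * Z.classOf) = Z.classOf)
    (hM : compound p P⁻¹ * Z.classOf = M) :
    (compound p P * M).transpose = compound p P * M := by
  rw [← hM, hsec, chain_classOf_transpose]

end Summit.HodgeConjecture.HodgeConjecture.Theorems.FormalCycleCriterion.Negative.ClassOfSymmetric
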